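import Summits.CriticalPhenomena.CardyFormulaZ2.Theorems.CardyIKTransportIKLinearTransportStubExchangeChain

/-!
# Stub `stub_ChainSteps` (line `pinned-diagram-exchange`, crux stmt-CriticalPhenomena-5076)

The exchange chain of `stub_ExchangeChain` with its INTERMEDIATE STATES exposed (Manolescu's
transport, arXiv:2502.08394 §5.3, tracks the extrema of mesoscopic clusters step by step along the
chain of adjacent-column exchanges of the Izergin–Korepin colour field, so the core needs every
intermediate state, not only the endpoint map).

Given the family of single exchange maps (hypothesis, of shape `exchangeKernels_IK`) and a finite
admissible schedule `(S t, i t)_{t < n}` (`i t ∈ S t ↔ i t + 1 ∉ S t`,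
`S (t + 1) = S t ∆ {i t, i t + 1}`) we exhibit
* kernels `T t`, chosen from the family on the schedule (same constants `C, c`), the identity map
  elsewhere;
* the per-step randomness `U t u :=` the bits of even index of the `t`-fold odd-index tail of the
  fresh randomness `u : Rnd = Set (Site 2 × ℕ)` (odd tail `{q | (q.1, 2 q.2 + 1) ∈ u}`, even bits
  `{q | (q.1, 2 q.2) ∈ u}`, as in `ExchangeChain`); it is measurable, reads the bits of each cell
  separately and commutes with vertical shifts definitionally;
* the states `X 0 x u = x`, `X (t + 1) x u = T t (X t x u) (U t u)` (recursion on `t`);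
and prove the LAWS: `(X t, U t)` carries `ν_{S 0} ⊗ β` to `ν_{S t} ⊗ β` for `t < n`, and `X n`
carries `ν_{S 0} ⊗ β` to `ν_{S n}`. Both follow from the invariant "`(X t, tail^[t])` carries
`ν_{S 0} ⊗ β` to `ν_{S t} ⊗ β` for `t ≤ n`" (induction on `t`, the step being the measure-preserving
map `(y, w) ↦ (T t y w_even, w_odd)` of `ExchangeChain.measurePreserving_step`) by projecting with
`ExchangeChain.measurePreserving_keepEven`, resp. `measurePreserving_fst`.
-/

noncomputable section

namespace Summit.CriticalPhenomena.CardyFormulaZ2.Theorems.IKLinearTransport.PinnedDiagramExchange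

open scoped BigOperators Topology Classical MeasureTheory ProbabilityTheory ENNReal symmDiff
open Filter Set Function MeasureTheory
open Literature.Probability.Percolation Literature.Probability.LatticeModels
open Literature.Probability.RandomPlanarGeometry

namespace ChainSteps

/-! ## §1 The odd-index tail of the randomness and the per-step randomness -/

/-- The `t`-fold odd-index tail of the fresh randomness is measurable. [folklore] -/
theorem measurable_tail (t : ℕ) :
    Measurable ((fun w : Rnd => ({q | (q.1, 2 * q.2 + 1) ∈ w} : Rnd))^[t]) :=
  ExchangeChain.measurable_odd.iterate t

/-- The per-step randomness (the even-index bits of the `t`-fold odd-index tail) is measurable.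
[folklore] -/
theorem measurable_U (t : ℕ) :
    Measurable (fun u : Rnd =>
      ({q | (q.1, 2 * q.2) ∈ (fun w : Rnd => ({q | (q.1, 2 * q.2 + 1) ∈ w} : Rnd))^[t] u} : Rnd)) :=
  ExchangeChain.measurable_even.comp (measurable_tail t)

/-- The `t`-fold odd-index tail reads the bits of each cell separately. [folklore] -/
theorem local_tail (v : Site 2) (u u' : Rnd) (h : ∀ k : ℕ, ((v, k) ∈ u ↔ (v, k) ∈ u')) (t : ℕ) :
    ∀ k : ℕ, ((v, k) ∈ (fun w : Rnd => ({q | (q.1, 2 * q.2 + 1) ∈ w} : Rnd))^[t] u ↔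
      (v, k) ∈ (fun w : Rnd => ({q | (q.1, 2 * q.2 + 1) ∈ w} : Rnd))^[t] u') := by
  induction t with
  | zero => exact h
  | succ t ih =>
    intro k
    rw [Function.iterate_succ_apply', Function.iterate_succ_apply']
    exact ih (2 * k + 1)

/-- The per-step randomness reads the bits of each cell separately. [folklore] -/
theorem local_U (t : ℕ) (u u' : Rnd) (v : Site 2) (h : ∀ k : ℕ, ((v, k) ∈ u ↔ (v, k) ∈ u'))
    (k : ℕ) :
    (v, k) ∈ ({q | (q.1, 2 * q.2) ∈ (fun w : Rnd => ({q | (q.1, 2 * q.2 + 1) ∈ w} : Rnd))^[t] u} :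
        Rnd) ↔
      (v, k) ∈ ({q | (q.1, 2 * q.2) ∈ (fun w : Rnd => ({q | (q.1, 2 * q.2 + 1) ∈ w} : Rnd))^[t] u'} :
        Rnd) :=
  local_tail v u u' h t (2 * k)

/-- The odd-index tail commutes with vertical shifts (definitionally), hence so do its iterates.
[folklore] -/
theorem ushift_tail (m : ℤ) (t : ℕ) (u : Rnd) :
    (fun w : Rnd => ({q | (q.1, 2 * q.2 + 1) ∈ w} : Rnd))^[t] (ushift m u) =
      ushift m ((fun w : Rnd => ({q | (q.1, 2 * q.2 + 1) ∈ w} : Rnd))^[t] u) :=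
  haveI hc : Function.Commute (fun w : Rnd => ({q | (q.1, 2 * q.2 + 1) ∈ w} : Rnd)) (ushift m) :=
    fun _ => rfl
  hc.iterate_left t u

/-- The per-step randomness commutes with vertical shifts. [folklore] -/
theorem ushift_U (t : ℕ) (m : ℤ) (u : Rnd) :
    ({q | (q.1, 2 * q.2) ∈ (fun w : Rnd => ({q | (q.1, 2 * q.2 + 1) ∈ w} : Rnd))^[t] (ushift m u)} :
        Rnd) =
      ushift m {q | (q.1, 2 * q.2) ∈ (fun w : Rnd => ({q | (q.1, 2 * q.2 + 1) ∈ w} : Rnd))^[t] u} := by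
  rw [ushift_tail]
  rfl

/-! ## §2 The law invariant of the chain with exposed intermediate states -/

/-- THE LAW INVARIANT: if each step map `T t` (`t < n`) carries `ν t ⊗ β` to `ν (t + 1)`, then the
pair (state after `t` steps, `t`-fold odd-index tail of the randomness) carries `ν 0 ⊗ β` to
`ν t ⊗ β` for every `t ≤ n`. Induction on `t`: the pair at time `t + 1` is the image of the pair at
time `t` under `(y, w) ↦ (T t y w_even, w_odd)`, which is measure preserving by
`ExchangeChain.measurePreserving_step`. [folklore] -/
theorem invariant (ν : ℕ → Measure Obs) (hν : ∀ t, SFinite (ν t)) (T : ℕ → Obs → Rnd → Obs)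
    (n : ℕ)
    (hT : ∀ t, t < n → MeasurePreserving (Function.uncurry (T t)) ((ν t).prod β) (ν (t + 1))) :
    ∀ t, t ≤ n → MeasurePreserving
      (fun xu : Obs × Rnd =>
        (Nat.rec (motive := fun _ => Obs) xu.1
          (fun s y => T s y
            {q | (q.1, 2 * q.2) ∈ (fun w : Rnd => ({q | (q.1, 2 * q.2 + 1) ∈ w} : Rnd))^[s] xu.2}) t,
          (fun w : Rnd => ({q | (q.1, 2 * q.2 + 1) ∈ w} : Rnd))^[t] xu.2))
      ((ν 0).prod β) ((ν t).prod β) := by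
  intro t
  induction t with
  | zero =>
    intro
    exact MeasurePreserving.id _
  | succ t ih =>
    intro ht
    haveI := hν t
    have h := (ExchangeChain.measurePreserving_step (hT t ht)).comp (ih (Nat.le_of_succ_le ht))
    convert h using 1
    funext xu
    exact Prod.ext rfl (Function.iterate_succ_apply' _ t xu.2)

end ChainSteps

/-! ## §3 The registered stub -/

/-- STUB `stub_ChainSteps` (line `pinned-diagram-exchange`): the exchange chain with its
intermediate states exposed. From the family of exchange kernels (hypothesis, of shape
`exchangeKernels_IK`, constants `C, c`) and a finite admissible schedule `(S t, i t)_{t < n}` we get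
kernels `T t` of the family along the schedule, per-step randomness `U t` (even-index bits of the
`t`-fold odd-index tail: measurable, cell-local, shift-covariant) and states
`X 0 x u = x`, `X (t + 1) x u = T t (X t x u) (U t u)`, measurable for `t ≤ n`, such that
`(X t, U t)` has law `ν_{S t} ⊗ β` under `ν_{S 0} ⊗ β` (`t < n`) and `X n` has law `ν_{S n}`.
[folklore] -/
theorem stub_ChainSteps :
    (∃ C c : ℝ, 0 < c ∧ ∀ (S : Set ℤ) (i : ℤ), (i ∈ S ↔ i + 1 ∉ S) →
        ∃ T : Obs → Rnd → Obs, IsExchangeKernel C c S i T) →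
    ∃ C c : ℝ, 0 < c ∧ ∀ (n : ℕ) (S : ℕ → Set ℤ) (i : ℕ → ℤ),
      (∀ t : ℕ, t < n → (i t ∈ S t ↔ i t + 1 ∉ S t) ∧ S (t + 1) = S t ∆ {i t, i t + 1}) →
      ∃ (T : ℕ → Obs → Rnd → Obs) (U : ℕ → Rnd → Rnd) (X : ℕ → Obs → Rnd → Obs),
        (∀ t : ℕ, t < n → IsExchangeKernel C c (S t) (i t) (T t)) ∧
        (∀ t : ℕ, Measurable (U t)) ∧
        (∀ (t : ℕ) (u u' : Rnd) (v : Site 2), (∀ k : ℕ, ((v, k) ∈ u ↔ (v, k) ∈ u')) →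
          ∀ k : ℕ, ((v, k) ∈ U t u ↔ (v, k) ∈ U t u')) ∧
        (∀ (t : ℕ) (m : ℤ) (u : Rnd), U t (ushift m u) = ushift m (U t u)) ∧
        (∀ (x : Obs) (u : Rnd), X 0 x u = x) ∧
        (∀ (t : ℕ) (x : Obs) (u : Rnd), X (t + 1) x u = T t (X t x u) (U t u)) ∧
        (∀ t : ℕ, t ≤ n → Measurable (Function.uncurry (X t))) ∧
        (∀ t : ℕ, t < n →
          ((νmix (S 0)).prod β).map (fun xu : Obs × Rnd => (X t xu.1 xu.2, U t xu.2)) = (νmix (S t)).prod β) ∧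
        ((νmix (S 0)).prod β).map (Function.uncurry (X n)) = νmix (S n) := by
  rintro ⟨C, c, hc, hK⟩
  refine ⟨C, c, hc, fun n S i hS => ?_⟩
  -- the kernels: chosen from the family along the schedule, the identity map elsewhere
  have hex : ∀ t : ℕ, ∃ T₀ : Obs → Rnd → Obs, t < n → IsExchangeKernel C c (S t) (i t) T₀ := by
    intro t
    by_cases ht : t < n
    · obtain ⟨T₀, hT₀⟩ := hK (S t) (i t) (hS t ht).1
      exact ⟨T₀, fun _ => hT₀⟩
    · exact ⟨fun x _ => x, fun h => absurd h ht⟩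
  choose T hTK using hex
  haveI hβ : IsProbabilityMeasure β := by unfold β; infer_instance
  have hν : ∀ t : ℕ, SFinite (νmix (S t)) := fun t => ExchangeChain.sFinite_nuMix (S t)
  -- each step of the schedule transports `ν_{S t} ⊗ β` to `ν_{S (t + 1)}`
  have hMP : ∀ t : ℕ, t < n →
      MeasurePreserving (Function.uncurry (T t)) ((νmix (S t)).prod β) (νmix (S (t + 1))) := by
    intro t ht
    obtain ⟨hm, hlaw, -⟩ := hTK t ht
    exact ⟨hm, by rw [hlaw, (hS t ht).2]⟩
  have hinv := ChainSteps.invariant (fun t => νmix (S t)) hν T n hMP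
  refine ⟨T,
    fun t u => {q | (q.1, 2 * q.2) ∈ (fun w : Rnd => ({q | (q.1, 2 * q.2 + 1) ∈ w} : Rnd))^[t] u},
    fun t x u => Nat.rec (motive := fun _ => Obs) x
      (fun s y => T s y
        {q | (q.1, 2 * q.2) ∈ (fun w : Rnd => ({q | (q.1, 2 * q.2 + 1) ∈ w} : Rnd))^[s] u}) t,
    hTK, ChainSteps.measurable_U, ChainSteps.local_U, ChainSteps.ushift_U,
    fun x u => rfl, fun t x u => rfl, ?_, ?_, ?_⟩
  · -- measurability of the states (first component of the invariant's map)
    intro t ht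
    exact measurable_fst.comp (hinv t ht).measurable
  · -- law of (state, per-step randomness): project the invariant with `(y, w) ↦ (y, w_even)`
    intro t ht
    haveI := hν t
    exact ((ExchangeChain.measurePreserving_keepEven (νmix (S t))).comp (hinv t ht.le)).map_eq
  · -- law of the final state: project the invariant on the first factor
    exact ((measurePreserving_fst (μ := νmix (S n)) (ν := β)).comp (hinv n le_rfl)).map_eq

end Summit.CriticalPhenomena.CardyFormulaZ2.Theorems.IKLinearTransport.PinnedDiagramExchange

end
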